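import Summits.HodgeConjecture.HodgeConjecture.Theorems.VHCAbelianSchemesRoadSecantQuotientResidualSpecialFibrePrime
import Summits.HodgeConjecture.HodgeConjecture.Theorems.VHCAbelianSchemesRoadPencilThroughDefs
import HarnessLib

/-!
# Road b02 (`VHCAbelianSchemesRoad`, D-0059) — THE W-RESTRICTED ELLIPTIC-POWER CARRIER STATEMENT AT `(6,3)` FOR THE PRIMED DOOR
# (`EllipticPowerExceptionalCarriersAt63TwPrime C`: served classes = the classes through the anchor that CONTINUE TO A SOMEWHERE-EXCEPTIONAL PENCIL)
# and its sufficiency for the residual stub `stub_residual_63_secantQuotientPinnedPrime` (item stmt-HodgeConjecture-20707, skeleton v3.3)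

research route conditional on HC_CM; not a corollary; Q11.4-sentence-2 already refuted in dim ≥ 3.

ONE DEFINITION + FACT-FREE GLUE (`HC_CM` nowhere; nothing asserted). Director-hodge g10 RULING R10.4 (6′) (HOME INBOX 2026-08-27T19:24:58Z, on ring-2 LEAD 158's
type-reading l.5270 of this lineage's census §5 (3)): the registered stub `stub_residual_63_secantQuotientPinnedPrime : ∀ C, SecantQuotientResidual63PinnedPrime C`
is ALREADY W-restricted (pencil-intrinsic `Under`-cell: it serves only the pencil's own class `W`); the OVER-STRENGTH this lineage flagged lives in the
HYPOTHESIS `hE : AnchoredCarrierAt (tw C AdmTw′) 6 3 𝔄^{ell,pol} (fun X _ ↦ algebraicClasses X 3)` of its own sufficiency theorem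
`secantQuotientResidual63PinnedPrime_of_ellipticPowerCarrierAt_of_under_not_not` (p550484 §3) — «EVERY rational algebraic class at EVERY polarised elliptic-power
sixfold is carried». The fix is lane-R helper work, not a skeleton change:

* §1 `EllipticPowerExceptionalCarriersAt63TwPrime C` := `AnchoredCarrierAt (tw C AdmTw′) 6 3 𝔄^{ell,pol} (fun X θ ↦ exceptionalPencilClassesThrough 6 3 X θ)` —
  the served classes at a polarised elliptic-power anchor `(X, θ)` are only the rational classes that CONTINUE TO A SOMEWHERE-EXCEPTIONAL CELL-SHAPED
  PENCIL through `(X, θ)` (`exceptionalPencilClassesThrough`, `VHCAbelianSchemesRoadPencilThroughDefs`), i.e. exactly the classes `W|` the residual can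
  present there. WEAKER than `hE` granted `exceptionalPencilClassesThrough 6 3 X θ ⊆ algebraicClasses X 3` at elliptic-power anchors (true — every Hodge
  class on an elliptic power is algebraic, Tate–Murasaki — kept as an EXPLICIT hypothesis: `ellipticPowerExceptionalCarriersAt63TwPrime_of_algebraicCarriers`).
* §2 THE SERVED-FIBRE TWIN: a cell-shaped pencil `(f, W)` in regime 2 (W not algebraic-Lefschetz on every fibre) with an elliptic-power fibre `𝒳_t` HAS A
  SERVED FIBRE for `(𝔄^{ell,pol}, exceptionalPencilClassesThrough n p)` — the pencil itself, polarised by the relative hyperplane class, witnesses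
  `W|_t ∈ exceptionalPencilClassesThrough n p 𝒳_t Θ|_t` (`hasServedFibre_exceptional_of_ellipticPowerFibre`; degree- and dimension-generic); hence
  `under_ellipticPowerFibre_of_ellipticPowerExceptionalCarriersAt` (door-generic) and **`secantQuotientResidual63PinnedPrime_of_ellipticPowerExceptionalCarriersAt63_of_under_not_not`**:
  the W-restricted carrier statement ∧ the primed doubly-residual cell (no pinned-served fibre, no elliptic-power fibre) ⟹ `SecantQuotientResidual63PinnedPrime C`
  — the same two-line excluded-middle proof as p550484 §3. Skeleton v3.3 ba3c7cae8f05833c, ring2-b06 g121's `rung_sixfoldMiddleTwPrime_of_…` and `closes` UNTOUCHED.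

Why it matters (this lineage's census, evidence n°17 on the item, §5 (3)): the class-level designs at `E⁶` serve SPECIFIC directions (`x_jθ²` by 3 diagonal
roots; the Weil class of `E³ × Ē³` by 32 roots); asking a carrier for every algebraic class at every polarisation is far more than the crux needs. START bytes:
ring-2 LEAD 158's scratch `tools-g158/session/edge/retypecheck/WRestrictedCarriersG158.lean` (md5 0742b9aa0c693765986509570285551d, never proposed), re-derived here.
Nothing here says any carrier statement, the residual, any cell ∕ rung ∕ crux, VHC, `HC_AV` or HC holds.
References: [cite: Bloch1972Semiregularity, Remark (7.5)] [cite: vanGeemen1994HodgeAV, §2.4, Thm. 4.3 and Thm. 4.11] [cite: Markman2025SecantWeil, Thm. 1.4.1 and Thm. 1.5.1]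
[cite: MoonenZarhin1999LowDim, Cor. 3.9] [cite: VoisinHodgeI2002, Thm. 6.25, Thm. 7.10 and §7.1.2] [cite: Hartshorne1977, II Ex. 4.9].
-/

noncomputable section

open CategoryTheory CategoryTheory.Limits AlgebraicGeometry Topology

-- the cell's namespace repeats the summit name (`Summit.HodgeConjecture.HodgeConjecture…`), as in every `Ring2*` file
set_option linter.dupNamespace false

namespace Summit.HodgeConjecture.HodgeConjecture.Ring2.SemiregularRepresentatives

open Literature.AlgebraicGeometry Literature.AlgebraicGeometry.Motives Literature.AlgebraicGeometry.Modules
open Literature.AlgebraicGeometry.HodgeTheory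
open Literature.AlgebraicTopology.SingularHomology
open Literature.Barriers.HodgeConjecture (divisorClassesSpan)
open Summit.Ventures.HSemireg (ObjClass)
open Summit.HodgeConjecture.HodgeConjecture.Ring2.Binders (exists_forall_isPolarizationClass_map_fiberι)

/-! ## §1 The W-restricted elliptic-power carrier statement -/

/-- **`EllipticPowerExceptionalCarriersAt63TwPrime C` — THE W-RESTRICTED ELLIPTIC-POWER CARRIER STATEMENT AT `(6,3)` FOR THE PRIMED TWISTED DOOR**
`tw C AdmTw′`, `AdmTw′ := gluableSigmaAdmissible ∨ bfSingleAdmissible′`: at every polarised `(X, θ)` with `X ≅ A₀ ~ E₀^{N+1}`, `dim A₀ = 6`, and every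
RATIONAL class `w` through `(X, θ)` that CONTINUES TO A SOMEWHERE-EXCEPTIONAL CELL-SHAPED PENCIL (`w ∈ exceptionalPencilClassesThrough 6 3 X θ`: a
one-parameter abelian scheme with every binder of the cell, a fibre `≅ X` polarised by the restriction `θ` of a global fibrewise-rational `(1,1)` class,
a global fibrewise-rational `(3,3)` class restricting to `w` there and NOT algebraic-Lefschetz on every fibre), there are degrees `I ∋ 3`, an
`AdmTw′`-admissible `B`-twisted datum `κ` on `X`, `a ≠ 0` and scalars with `κ₃ = a·w + c₃·θ³`, `κ_q = c_q·θ^q` (`q ∈ I`, `q ≠ 3`). The served-class map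
of this lineage's `hE` (`algebraicClasses X 3`) restricted to what the residual can present. OPEN; a HYPOTHESIS wherever used; sufficient for the residual on
the pencils through an elliptic-power fibre (§2). [cite: Bloch1972Semiregularity, Remark (7.5)] [cite: vanGeemen1994HodgeAV, Thm. 4.3 and Thm. 4.11]
[cite: Markman2025SecantWeil, Thm. 1.5.1] [status: open] -/
@[conjecture] def EllipticPowerExceptionalCarriersAt63TwPrime (C : ChernCharacterBetti) : Prop :=
  AnchoredCarrierAt (Literature.AlgebraicGeometry.HodgeTheory.twistedReflexiveClass C
      (fun n X₀ I E => Summit.Ventures.HSemireg.gluableSigmaAdmissible n X₀ I E ∨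
        Literature.AlgebraicGeometry.HodgeTheory.bfSingleAdmissible' n X₀ I E)) 6 3
    (fun X θ ↦ (∃ (A₀ E₀ : AbelianVariety ℂ) (N : ℕ), A₀.dim = 6 ∧ E₀.dim = 1 ∧ A₀.IsIsogenous (E₀.powSucc N) ∧
      Nonempty (A₀.X ≅ X)) ∧ IsPolarizationClass 6 X θ)
    (fun X θ ↦ exceptionalPencilClassesThrough 6 3 X θ)

variable {C : ChernCharacterBetti}

/-- **The W-restricted statement is WEAKER than this lineage's `hE`** (served set `algebraicClasses X 3`), granted the inclusion
`exceptionalPencilClassesThrough 6 3 X θ ⊆ algebraicClasses X 3` at polarised elliptic-power anchors (every Hodge class on an elliptic power is algebraic —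
kept as an explicit hypothesis here, never asserted): `anchoredCarrierAt_anti`. [cite: vanGeemen1994HodgeAV, Thm. 4.3] [cite: Bloch1972Semiregularity, Remark (7.5)] -/
theorem ellipticPowerExceptionalCarriersAt63TwPrime_of_algebraicCarriers
    (hsub : ∀ (X : SchemeOver ℂ) (θ : complexBetti X 2),
      ((∃ (A₀ E₀ : AbelianVariety ℂ) (N : ℕ), A₀.dim = 6 ∧ E₀.dim = 1 ∧ A₀.IsIsogenous (E₀.powSucc N) ∧ Nonempty (A₀.X ≅ X)) ∧
        IsPolarizationClass 6 X θ) →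
      exceptionalPencilClassesThrough 6 3 X θ ⊆ (algebraicClasses X 3 : Set (complexBetti X (2 * 3))))
    (hE : AnchoredCarrierAt (Literature.AlgebraicGeometry.HodgeTheory.twistedReflexiveClass C
        (fun n X₀ I E => Summit.Ventures.HSemireg.gluableSigmaAdmissible n X₀ I E ∨
          Literature.AlgebraicGeometry.HodgeTheory.bfSingleAdmissible' n X₀ I E)) 6 3
      (fun X θ ↦ (∃ (A₀ E₀ : AbelianVariety ℂ) (N : ℕ), A₀.dim = 6 ∧ E₀.dim = 1 ∧ A₀.IsIsogenous (E₀.powSucc N) ∧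
        Nonempty (A₀.X ≅ X)) ∧ IsPolarizationClass 6 X θ)
      (fun X _ ↦ (algebraicClasses X 3 : Set (complexBetti X (2 * 3))))) :
    EllipticPowerExceptionalCarriersAt63TwPrime C :=
  anchoredCarrierAt_anti (fun _ _ h ↦ h) hsub hE

/-! ## §2 The served-fibre twin and the residual reduction -/

section Served

variable {𝒪 : ObjClass} {n p : ℕ} {𝒳 S : SchemeOver ℂ} {f : 𝒳 ⟶ S}

/-- **A CELL-SHAPED PENCIL IN REGIME 2 WITH AN ELLIPTIC-POWER FIBRE IS SERVED THERE FOR «EXCEPTIONAL-PENCIL CLASSES»**: with every binder of the cell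
(smooth projective of relative dimension `n`, quasi-projective total space, smooth irreducible affine base of Krull dimension one, abelian fibres, a section),
`W` fibrewise rational `(p,p)` and NOT algebraic-Lefschetz on every fibre, and a fibre `𝒳_t ≅ A₀ ~ E₀^{N+1}`: polarise by the relative hyperplane class `Θ`
(`exists_forall_isPolarizationClass_map_fiberι`); then `(𝒳_t, Θ|_t)` is a polarised elliptic-power anchor and `W|_t ∈ exceptionalPencilClassesThrough n p 𝒳_t Θ|_t`
— witnessed by the pencil itself at the identity chart. [cite: VoisinHodgeI2002, Thm. 6.25, Thm. 7.10 and §7.1.2] [cite: Hartshorne1977, II Ex. 4.9]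
[cite: Bloch1972Semiregularity, Remark (7.5)] -/
theorem hasServedFibre_exceptional_of_ellipticPowerFibre (hf : IsSmoothProjectiveFamily f n) (h𝒳 : IsQuasiProjectiveOver 𝒳)
    (hirr : IrreducibleSpace S.left) (haff : IsAffine S.left) (hsm : AlgebraicGeometry.Smooth S.hom) (hdim : topologicalKrullDim S.left = 1)
    (hab : ∀ s : ComplexPoints S, ∃ A' : AbelianVariety ℂ, A'.dim = n ∧ Nonempty (A'.X ≅ fiberOver f s))
    (hsec : ∃ e : S ⟶ 𝒳, e ≫ f = 𝟙 S)
    {t : ComplexPoints S} {A₀ E₀ : AbelianVariety ℂ} {N : ℕ} (hd : A₀.dim = n) (hE₀ : E₀.dim = 1) (hiso : A₀.IsIsogenous (E₀.powSucc N))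
    (e₀ : A₀.X ≅ fiberOver f t) (W : complexBetti 𝒳 (2 * p))
    (hW : ∀ s : ComplexPoints S, IsRationalClass (complexBetti.map (fiberι f s) (2 * p) W) ∧
      IsOfHodgeType n (fiberOver f s) (2 * p) p p (complexBetti.map (fiberι f s) (2 * p) W))
    (hexc : ¬ ∀ s : ComplexPoints S,
      complexBetti.map (fiberι f s) (2 * p) W ∈ algebraicClasses (fiberOver f s) p ∧
      complexBetti.map (fiberι f s) (2 * p) W ∈ divisorClassesSpan (fiberOver f s) n p) :
    HasServedFibre n p
      (fun X θ ↦ (∃ (A₀ E₀ : AbelianVariety ℂ) (N : ℕ), A₀.dim = n ∧ E₀.dim = 1 ∧ A₀.IsIsogenous (E₀.powSucc N) ∧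
        Nonempty (A₀.X ≅ X)) ∧ IsPolarizationClass n X θ)
      (fun X θ ↦ exceptionalPencilClassesThrough n p X θ) f W := by
  haveI := haff
  haveI : IsSeparated S.hom := isSeparated_hom_of_isAffine S
  obtain ⟨Θ, hΘ⟩ := exists_forall_isPolarizationClass_map_fiberι f hf h𝒳
  have hΘQ : ∀ s : ComplexPoints S, IsRationalClass (complexBetti.map (fiberι f s) 2 Θ) := fun s ↦ (hΘ s).isRationalClass
  have hΘH : ∀ s : ComplexPoints S, IsOfHodgeType n (fiberOver f s) 2 1 1 (complexBetti.map (fiberι f s) 2 Θ) := fun s ↦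
    isOfHodgeType_of_mem_algebraicClasses_of_isSmoothProjective (hf.isSmoothProjective s) 1 (hΘ s).mem_algebraicClasses
  refine ⟨t, Θ, hΘQ, hΘH, ⟨⟨A₀, E₀, N, hd, hE₀, hiso, ⟨e₀⟩⟩, hΘ t⟩, ?_⟩
  refine ⟨𝒳, S, f, t, Iso.refl _, Θ, W, hf, h𝒳, hirr, haff, hsm, hdim, hab, hsec, hΘQ, hΘH, hW, ?_, ?_, hexc⟩
  · rw [Iso.refl_inv, complexBetti.map_id]; rfl
  · rw [Iso.refl_inv, complexBetti.map_id]; rfl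

/-- **W-RESTRICTED ELLIPTIC-POWER CARRIERS GIVE EVERY CELL ON THE PENCILS WITH AN ELLIPTIC-POWER FIBRE** (door-, degree-generic): `AnchoredCarrierAt 𝒪 n p`
at «polarised elliptic-power anchors» ∕ «exceptional-pencil classes» ⟹ the cell `(n, p)` under «some fibre is isomorphic to an abelian `n`-fold isogenous
to a power of an elliptic curve» (`exists_lefAtDatum_of_anchoredCarrierAt` at the served fibre above). [cite: Bloch1972Semiregularity, Remark (7.5)]
[cite: vanGeemen1994HodgeAV, Thm. 4.3 and §2.4] -/
theorem under_ellipticPowerFibre_of_ellipticPowerExceptionalCarriersAt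
    (hA : AnchoredCarrierAt 𝒪 n p
      (fun X θ ↦ (∃ (A₀ E₀ : AbelianVariety ℂ) (N : ℕ), A₀.dim = n ∧ E₀.dim = 1 ∧ A₀.IsIsogenous (E₀.powSucc N) ∧
        Nonempty (A₀.X ≅ X)) ∧ IsPolarizationClass n X θ)
      (fun X θ ↦ exceptionalPencilClassesThrough n p X θ)) :
    LefAtExceptionalRegimeAtUnder 𝒪 n p (fun _ S f _ ↦ ∃ (t : ComplexPoints S) (A₀ E₀ : AbelianVariety ℂ) (N : ℕ),
      A₀.dim = n ∧ E₀.dim = 1 ∧ A₀.IsIsogenous (E₀.powSucc N) ∧ Nonempty (A₀.X ≅ fiberOver f t)) := by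
  intro 𝒳 S f hf h𝒳 hirr haff hsm hdim hab hsec W hW s₀ halg hexc hP
  obtain ⟨t, A₀, E₀, N, hd, hE₀, hiso, ⟨e₀⟩⟩ := hP
  exact exists_lefAtDatum_of_anchoredCarrierAt hA hf W hW
    (hasServedFibre_exceptional_of_ellipticPowerFibre hf h𝒳 hirr haff hsm hdim hab hsec hd hE₀ hiso e₀ W hW hexc)

end Served

/-- **THE RESIDUAL STUB FROM THE W-RESTRICTED CARRIERS AND THE DOUBLY RESIDUAL** (the W-restricted twin of p550484's
`secantQuotientResidual63PinnedPrime_of_ellipticPowerCarrierAt_of_under_not_not`; same two-line excluded-middle proof): if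
`EllipticPowerExceptionalCarriersAt63TwPrime C` holds AND the primed cell `(6,3)` holds on the pencils with NO pinned-served fibre AND NO elliptic-power
fibre, then `SecantQuotientResidual63PinnedPrime C` — the type of skeleton v3.3's `stub_residual_63_secantQuotientPinnedPrime` at `C`.
[cite: vanGeemen1994HodgeAV, Thm. 4.3, Thm. 4.11 and Lemma 5.2] [cite: Markman2025SecantWeil, Thm. 1.5.1 and §1.5] [cite: Bloch1972Semiregularity, Remark (7.5)] -/
theorem secantQuotientResidual63PinnedPrime_of_ellipticPowerExceptionalCarriersAt63_of_under_not_not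
    (hE : EllipticPowerExceptionalCarriersAt63TwPrime C)
    (hR : LefAtExceptionalRegimeAtUnder (Literature.AlgebraicGeometry.HodgeTheory.twistedReflexiveClass C
        (fun n X₀ I E => Summit.Ventures.HSemireg.gluableSigmaAdmissible n X₀ I E ∨
          Literature.AlgebraicGeometry.HodgeTheory.bfSingleAdmissible' n X₀ I E)) 6 3
      (fun _ S f W ↦ ¬ HasServedFibre 6 3 (fun X θ ↦ secantQuotientAnchorsPinned X θ)
          (fun X θ ↦ secantQuotientServedClassesPinned X θ) f W ∧
        ¬ ∃ (t : ComplexPoints S) (A₀ E₀ : AbelianVariety ℂ) (N : ℕ),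
          A₀.dim = 6 ∧ E₀.dim = 1 ∧ A₀.IsIsogenous (E₀.powSucc N) ∧ Nonempty (A₀.X ≅ fiberOver f t))) :
    SecantQuotientResidual63PinnedPrime C := by
  intro 𝒳 S f hf h𝒳 hirr haff hsm hdim hab hsec W hW s₀ halg hexc hns
  by_cases hell : ∃ (t : ComplexPoints S) (A₀ E₀ : AbelianVariety ℂ) (N : ℕ),
      A₀.dim = 6 ∧ E₀.dim = 1 ∧ A₀.IsIsogenous (E₀.powSucc N) ∧ Nonempty (A₀.X ≅ fiberOver f t)
  · exact under_ellipticPowerFibre_of_ellipticPowerExceptionalCarriersAt hE f hf h𝒳 hirr haff hsm hdim hab hsec W hW s₀ halg hexc hell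
  · exact hR f hf h𝒳 hirr haff hsm hdim hab hsec W hW s₀ halg hexc ⟨hns, hell⟩

/-- **… in the `∀ C` shape of the registered stub**: `(∀ C, EllipticPowerExceptionalCarriersAt63TwPrime C) ∧ (∀ C, doubly residual at C) ⟹
∀ C, SecantQuotientResidual63PinnedPrime C`. [cite: Bloch1972Semiregularity, Remark (7.5)] [cite: vanGeemen1994HodgeAV, Thm. 4.11] -/
theorem forall_secantQuotientResidual63PinnedPrime_of_ellipticPowerExceptionalCarriersAt63_of_under_not_not
    (hE : ∀ C : ChernCharacterBetti, EllipticPowerExceptionalCarriersAt63TwPrime C)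
    (hR : ∀ C : ChernCharacterBetti, LefAtExceptionalRegimeAtUnder (Literature.AlgebraicGeometry.HodgeTheory.twistedReflexiveClass C
        (fun n X₀ I E => Summit.Ventures.HSemireg.gluableSigmaAdmissible n X₀ I E ∨
          Literature.AlgebraicGeometry.HodgeTheory.bfSingleAdmissible' n X₀ I E)) 6 3
      (fun _ S f W ↦ ¬ HasServedFibre 6 3 (fun X θ ↦ secantQuotientAnchorsPinned X θ)
          (fun X θ ↦ secantQuotientServedClassesPinned X θ) f W ∧
        ¬ ∃ (t : ComplexPoints S) (A₀ E₀ : AbelianVariety ℂ) (N : ℕ),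
          A₀.dim = 6 ∧ E₀.dim = 1 ∧ A₀.IsIsogenous (E₀.powSucc N) ∧ Nonempty (A₀.X ≅ fiberOver f t))) :
    ∀ C : ChernCharacterBetti, SecantQuotientResidual63PinnedPrime C :=
  fun C ↦ secantQuotientResidual63PinnedPrime_of_ellipticPowerExceptionalCarriersAt63_of_under_not_not (hE C) (hR C)

end Summit.HodgeConjecture.HodgeConjecture.Ring2.SemiregularRepresentatives

end
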